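import Summits.CriticalPhenomena.PercolationContinuityZ3.Theorems.PercNearOneGluingNoHeavyLowerTailKnQuestion8CoefficientwiseCoreClassDomPocketFree
import HarnessLib

/-!
# Cluster bookkeeping for a terminal leaf, and Harris' inequality in product form

Support file (`--supports stmt-CriticalPhenomena-4575`, closed), prover `prim-cplus-coupling` (gen 30).  No definitions, no notations, no named facts,
no sorries; standard axioms.  Memo `prim-cplus-coupling/A5-COUPLING-gen30.md` §3.3.  Consumed by `…CoreClassDomLeaf` (THEOREM LEAF).
* `openCluster_leaf_root_insert` — for a new edge `e` with `ends e = s(a′, a)` and `a′` on no edge of `c`: `C_{a′}(insert e c) = insert a′ (C_a c)`;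
* `openCluster_leaf_other_insert_subset` — for `b ≠ a′`: `C_b(insert e c) ⊆ C_b(c) ∪ {a′ if a ∈ C_b(c)}`;
* `sum_mul_sdiff_le_sum_mul` — `Σ_{ω ⊆ E} F(ω)G(E∖ω) ≤ Σ_{ω ⊆ E} F(ω)G(ω)` for monotone `F, G` (from `harris_twoColouring_subpowerset`).
[cite: KozmaNitzan2024, Questions 8–9 (§5.5 p. 36) (context: the Question-8 pocket covariance programme)]
-/

namespace Summit.CriticalPhenomena.PercolationContinuityZ3.Theorems

open Finset Literature.Probability.Percolation

namespace Coefficientwise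

variable {ι V : Type*}

section leaf

variable (ends : ι → Sym2 V) {e : ι} {a a' : V}

/-- Pendant edge at a new root: if `ends e = s(a′, a)` and `a′` lies on no edge of `c`, then `C_{a′}(insert e c) = insert a′ (C_a(c))`.
[cite: KozmaNitzan2024, §5.5 (context only; folklore)] -/
theorem openCluster_leaf_root_insert [DecidableEq ι] (c : Finset ι) (hends : ends e = s(a', a)) (ha' : ∀ i ∈ c, a' ∉ ends i) :
    openCluster (ends '' (↑(insert e c) : Set ι)) a' = insert a' (openCluster (ends '' (↑c : Set ι)) a) := by
  apply Set.Subset.antisymm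
  · refine openCluster_subset_of_closed ends (insert e c) a' (S := insert a' (openCluster (ends '' (↑c : Set ι)) a)) (Set.mem_insert _ _) ?_
    intro i hi u v he hu
    rcases Finset.mem_insert.mp hi with hie | hi
    · -- the leaf edge: both ends lie in the set
      have huv : s(u, v) = s(a', a) := by rw [← he, hie, hends]
      rw [Sym2.eq_iff] at huv
      rcases huv with ⟨_, hv⟩ | ⟨_, hv⟩
      · rw [hv]; exact Set.mem_insert_of_mem _ (mem_openCluster_self _ _)
      · rw [hv]; exact Set.mem_insert _ _
    · rcases hu with hu | hu
      · exact absurd (by rw [he, hu]; exact Sym2.mem_mk_left a' v) (ha' i hi)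
      · exact Set.mem_insert_of_mem _ (mem_openCluster_of_edge ends hi he hu)
  · intro y hy
    rcases hy with hy | hy
    · rw [hy]; exact mem_openCluster_self _ _
    · have ha : a ∈ openCluster (ends '' (↑(insert e c) : Set ι)) a' :=
        mem_openCluster_of_edge ends (Finset.mem_insert_self e c) hends (mem_openCluster_self _ _)
      have hy' : y ∈ openCluster (ends '' (↑(insert e c) : Set ι)) a := openCluster_image_mono ends (Finset.subset_insert e c) a hy
      exact SimpleGraph.Reachable.trans ha hy'

/-- Pendant edge, other roots: for `b ≠ a′`, `C_b(insert e c) ⊆ C_b(c) ∪ {a′ if a ∈ C_b(c)}` (`ends e = s(a′,a)`, `a′` on no edge of `c`).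
[cite: KozmaNitzan2024, §5.5 (context only; folklore)] -/
theorem openCluster_leaf_other_insert_subset [DecidableEq ι] (c : Finset ι) {b : V} (hends : ends e = s(a', a)) (ha' : ∀ i ∈ c, a' ∉ ends i)
    (haa : a' ≠ a) (hb : b ≠ a') :
    openCluster (ends '' (↑(insert e c) : Set ι)) b ⊆ openCluster (ends '' (↑c : Set ι)) b ∪ {y | y = a' ∧ a ∈ openCluster (ends '' (↑c : Set ι)) b} := by
  have ha'c : a' ∉ openCluster (ends '' (↑c : Set ι)) b := by
    intro h
    obtain ⟨i, hi, hai⟩ := exists_edge_of_mem_openCluster ends h hb.symm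
    exact ha' i hi hai
  refine openCluster_subset_of_closed ends (insert e c) b
    (S := openCluster (ends '' (↑c : Set ι)) b ∪ {y | y = a' ∧ a ∈ openCluster (ends '' (↑c : Set ι)) b}) (Or.inl (mem_openCluster_self _ _)) ?_
  intro i hi u v he hu
  rcases Finset.mem_insert.mp hi with hie | hi
  · have huv : s(u, v) = s(a', a) := by rw [← he, hie, hends]
    rw [Sym2.eq_iff] at huv
    rcases huv with ⟨hu', hv⟩ | ⟨hu', hv⟩
    · -- `u = a'`: then `u ∈ S` forces `a ∈ C_b(c)`, and `v = a`
      rcases hu with hu | ⟨_, hu⟩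
      · rw [hu'] at hu; exact absurd hu ha'c
      · rw [hv]; exact Or.inl hu
    · -- `u = a`, `v = a'`
      rcases hu with hu | ⟨hu2, _⟩
      · rw [hv]; exact Or.inr ⟨rfl, by rw [← hu']; exact hu⟩
      · exact absurd (hu2.symm.trans hu') haa
  · rcases hu with hu | ⟨hu1, _⟩
    · exact Or.inl (mem_openCluster_of_edge ends hi he hu)
    · exact absurd (by rw [he, hu1]; exact Sym2.mem_mk_left a' v) (ha' i hi)

end leaf

/-- Harris in product form on a sub-powerset: for monotone `F, G` with `F, G ≥ 0` not needed, `Σ_{ω ⊆ E} F(ω)G(E∖ω) ≤ Σ_{ω ⊆ E} F(ω)G(ω)`.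
[cite: KozmaNitzan2024, §5.5 (context: Harris 1960)] -/
theorem sum_mul_sdiff_le_sum_mul [DecidableEq ι] (E : Finset ι) (F G : Finset ι → ℝ) (hF : Monotone F) (hG : Monotone G) :
    ∑ ω ∈ E.powerset, F ω * G (E \ ω) ≤ ∑ ω ∈ E.powerset, F ω * G ω := by
  have key := harris_twoColouring_subpowerset E F G hF hG
  have e1 : ∑ ω ∈ E.powerset, (F ω - F (E \ ω)) * (G ω - G (E \ ω)) =
      (∑ ω ∈ E.powerset, F ω * G ω) + (∑ ω ∈ E.powerset, F (E \ ω) * G (E \ ω))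
        - (∑ ω ∈ E.powerset, F ω * G (E \ ω)) - (∑ ω ∈ E.powerset, F (E \ ω) * G ω) := by
    rw [← Finset.sum_add_distrib, ← Finset.sum_sub_distrib, ← Finset.sum_sub_distrib]
    refine Finset.sum_congr rfl fun ω _ => by ring
  have e2 : ∑ ω ∈ E.powerset, F (E \ ω) * G (E \ ω) = ∑ ω ∈ E.powerset, F ω * G ω :=
    sum_powerset_sdiff E (fun ω => F ω * G ω)
  have e3 : ∑ ω ∈ E.powerset, F (E \ ω) * G ω = ∑ ω ∈ E.powerset, F ω * G (E \ ω) := by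
    rw [← sum_powerset_sdiff E (fun ω => F ω * G (E \ ω))]
    refine Finset.sum_congr rfl fun ω hω => ?_
    rw [Finset.sdiff_sdiff_eq_self (Finset.mem_powerset.mp hω)]
  rw [e1, e2, e3] at key
  linarith

end Coefficientwise

end Summit.CriticalPhenomena.PercolationContinuityZ3.Theorems
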